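import Mathlib.RingTheory.WittVector.Complete
import Mathlib.RingTheory.WittVector.Frobenius
import HarnessLib

/-!
# `φ(x) ≡ xᵖ (mod p)` in the Witt vectors of a perfect ring

Topic `Literature/NumberTheory/PAdicHodge`; namespace `Literature.NumberTheory.PAdicHodge`. THEOREMS ONLY. For a perfect ring `k`
of characteristic `p` and `x ∈ 𝕎(k)`: the Witt-vector Frobenius is a Frobenius LIFT, `frobenius x − xᵖ ∈ p·𝕎(k)`
(`frobenius_sub_pow_mem_span_p`; both sides have zeroth component `x₀ᵖ`, and an element of `𝕎(k)` with vanishing zeroth component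
is a multiple of `p`, Mathlib `WittVector.mem_span_p_iff_coeff_zero_eq_zero`), with the explicit form `frobenius x = xᵖ + p·h`
(`exists_frobenius_eq_pow_add`). On `𝔸_inf(F) = 𝕎(𝒪_{ℂ_F}♭)` this is the hypothesis `φ(y) = yᵖ + p·h` of the Frobenius-annihilation
theorems `RingTheory.FormalGroups.PadicLogSeries.exists_evalₐ_frobenius_honda_eq` / `frobenius_honda_eq_zero_of_tower` (φ-road of line
`kato_lever`, crux K★ `stmt-BirchSwinnertonDyer-22226`, memo `Lines/kato-lever-K2-phi-road.md`). Infrastructure only.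

## References
* J.-P. Serre, *Local Fields* (1979), Ch. II §6 (Witt vectors: `F`, `V`, `FV = p`). [SerreLocalFields1979]
* L. Berger, *Représentations p-adiques et équations différentielles*, Invent. Math. 148 (2002), §1.2. [BergerLaurent2002]
-/

noncomputable section

namespace Literature.NumberTheory.PAdicHodge

open WittVector

variable {p : ℕ} [hp : Fact p.Prime] {k : Type*} [CommRing k] [CharP k p] [PerfectRing k p]

/-- **`φ(x) − xᵖ ∈ p·𝕎(k)`** for a perfect ring `k` of characteristic `p`: the Witt-vector Frobenius lifts the Frobenius of
`𝕎(k)/p = k`. [cite: SerreLocalFields1979, Ch. II §6] -/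
theorem frobenius_sub_pow_mem_span_p (x : WittVector p k) :
    frobenius x - x ^ p ∈ Ideal.span {(p : WittVector p k)} := by
  rw [WittVector.mem_span_p_iff_coeff_zero_eq_zero, ← constantCoeff_apply, map_sub, map_pow, constantCoeff_apply,
    constantCoeff_apply, coeff_frobenius_charP, sub_self]

/-- **`φ(x) = xᵖ + p·h`** for some `h ∈ 𝕎(k)`. [cite: SerreLocalFields1979, Ch. II §6] -/
theorem exists_frobenius_eq_pow_add (x : WittVector p k) :
    ∃ h : WittVector p k, frobenius x = x ^ p + (p : WittVector p k) * h := by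
  obtain ⟨h, hh⟩ := Ideal.mem_span_singleton'.1 (frobenius_sub_pow_mem_span_p x)
  exact ⟨h, by rw [mul_comm, hh, add_sub_cancel]⟩

end Literature.NumberTheory.PAdicHodge

end
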